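import Literature.AlgebraicGeometry.Resolution.RegularQuotientIdeal
import Mathlib.RingTheory.MvPowerSeries.Inverse
import Mathlib.RingTheory.MvPowerSeries.Basic
import HarnessLib

/-!
# Two lemmas for the formal-to-étale bridge: the maximal ideal of `k⟦X₁, …, X_d⟧`, and products
of independent parameters generate radical ideals

Topic: `Literature/AlgebraicGeometry/Resolution`. Commutative algebra used by
`FormalNormalCrossingsEtale.lean` (de Jong 1996, 4.25 (i)/4.28 via Artin approximation):

* `MvPowerSeries.mem_span_range_X_of_constantCoeff_eq_zero` — in `R⟦Xᵢ : i ∈ σ⟧` (`σ` finite,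
  linearly ordered) a power series without constant term lies in the ideal `(Xᵢ : i ∈ σ)`:
  split it according to the least variable occurring in each monomial and use
  `MvPowerSeries.X_dvd_iff`; hence `maximalIdeal_mvPowerSeries_eq_span_range_X` over a field.
* `span_singleton_prod_eq_iInf_of_linearIndependent_toCotangent` — in a regular local ring,
  for `f₁, …, f_c ∈ 𝔪` with linearly independent differentials,
  `(f₁ ⋯ f_c) = ⋂ᵢ (fᵢ)` (the `fᵢ` form a regular sequence in any order, tree
  `mem_span_image_of_mul_mem_of_linearIndependent_toCotangent`), so `(f₁ ⋯ f_c)` is a radical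
  ideal (`isRadical_span_singleton_prod_of_linearIndependent_toCotangent`), the `(fᵢ)` being
  prime.

## Sources

* H. Matsumura, *Commutative Ring Theory* (1986), Thm. 14.2 (for the regular-sequence property).
-/

noncomputable section

open IsLocalRing

namespace Literature.AlgebraicGeometry.Resolution

/-! ## The maximal ideal of a power series ring in finitely many variables -/

section PowerSeries

variable {σ : Type*} [Fintype σ] [LinearOrder σ] {R : Type*} [CommRing R]

/-- **A power series without constant term lies in the ideal of the variables** (finitely
many, linearly ordered variables): write `φ = ∑ᵢ ψᵢ` where `ψᵢ` collects the monomials of `φ`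
whose least variable is `Xᵢ`; each `ψᵢ` is divisible by `Xᵢ` (`MvPowerSeries.X_dvd_iff`).
[folklore] -/
theorem MvPowerSeries.mem_span_range_X_of_constantCoeff_eq_zero {φ : MvPowerSeries σ R}
    (hφ : MvPowerSeries.constantCoeff φ = 0) :
    φ ∈ Ideal.span (Set.range (MvPowerSeries.X : σ → MvPowerSeries σ R)) := by
  classical
  -- `P i e`: the least variable of the monomial `e` is `i`
  let P : σ → (σ →₀ ℕ) → Prop := fun i e => e i ≠ 0 ∧ ∀ j < i, e j = 0
  let ψ : σ → MvPowerSeries σ R := fun i e => if P i e then MvPowerSeries.coeff e φ else 0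
  have hψ : ∀ i e, MvPowerSeries.coeff e (ψ i) = if P i e then MvPowerSeries.coeff e φ else 0 :=
    fun i e => rfl
  have hdvd : ∀ i, (MvPowerSeries.X i : MvPowerSeries σ R) ∣ ψ i := fun i =>
    MvPowerSeries.X_dvd_iff.mpr fun m hm => by
      rw [hψ, if_neg]
      exact fun h => h.1 hm
  have hsum : φ = ∑ i, ψ i := by
    ext e
    rw [map_sum]
    by_cases he : e = 0
    · subst he
      rw [MvPowerSeries.coeff_zero_eq_constantCoeff_apply, hφ]
      symm
      refine Finset.sum_eq_zero fun i _ => ?_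
      rw [hψ, if_neg]
      exact fun h => h.1 rfl
    · -- the least variable `i₀` of `e`
      have hne : e.support.Nonempty := Finsupp.support_nonempty_iff.mpr he
      have hi₀ : P (e.support.min' hne) e := by
        refine ⟨Finsupp.mem_support_iff.mp (Finset.min'_mem _ _), fun j hj => ?_⟩
        by_contra h
        exact absurd (Finset.min'_le _ _ (Finsupp.mem_support_iff.mpr h)) (not_le.mpr hj)
      have huniq : ∀ i, P i e → i = e.support.min' hne := by
        rintro i ⟨hi, hlt⟩
        refine le_antisymm ?_ (Finset.min'_le _ _ (Finsupp.mem_support_iff.mpr hi))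
        by_contra h
        exact hi₀.1 (hlt _ (not_le.mp h))
      rw [Finset.sum_eq_single (e.support.min' hne) (fun i _ hi => by
          rw [hψ, if_neg]
          exact fun h => hi (huniq i h)) (fun h => (h (Finset.mem_univ _)).elim),
        hψ, if_pos hi₀]
  rw [hsum]
  refine Ideal.sum_mem _ fun i _ => ?_
  obtain ⟨q, hq⟩ := hdvd i
  rw [hq]
  exact Ideal.mul_mem_right _ _ (Ideal.subset_span ⟨i, rfl⟩)

/-- **The maximal ideal of `k⟦Xᵢ : i ∈ σ⟧`** (`k` a field, `σ` finite and linearly ordered) is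
generated by the variables. [folklore] -/
theorem maximalIdeal_mvPowerSeries_eq_span_range_X (k : Type*) [Field k] :
    maximalIdeal (MvPowerSeries σ k) =
      Ideal.span (Set.range (MvPowerSeries.X : σ → MvPowerSeries σ k)) := by
  apply le_antisymm
  · intro φ hφ
    apply MvPowerSeries.mem_span_range_X_of_constantCoeff_eq_zero
    rw [mem_maximalIdeal, mem_nonunits_iff, MvPowerSeries.isUnit_iff_constantCoeff] at hφ
    by_contra h
    exact hφ (Ne.isUnit h)
  · rw [Ideal.span_le]
    rintro _ ⟨i, rfl⟩
    rw [SetLike.mem_coe, mem_maximalIdeal, mem_nonunits_iff,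
      MvPowerSeries.isUnit_iff_constantCoeff, MvPowerSeries.constantCoeff_X]
    exact not_isUnit_zero

end PowerSeries

/-! ## Products of elements with independent differentials -/

section Regular

variable {R : Type*} [CommRing R] [IsRegularLocalRing R] {c : ℕ} (f : Fin c → R)
  (hf : ∀ i, f i ∈ maximalIdeal R)
  (hli : LinearIndependent (ResidueField R) fun i => (maximalIdeal R).toCotangent ⟨f i, hf i⟩)

include hli in
/-- In a regular local ring, for `f₁, …, f_c ∈ 𝔪` with linearly independent differentials and a
finite set `s` of indices, `(∏_{i ∈ s} fᵢ) = ⋂_{i ∈ s} (fᵢ)` (induction on `s`, the `fᵢ`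
forming a regular sequence in any order). [folklore] -/
theorem span_singleton_prod_eq_iInf_of_linearIndependent_toCotangent (s : Finset (Fin c)) :
    Ideal.span {∏ i ∈ s, f i} = ⨅ i ∈ s, Ideal.span {f i} := by
  classical
  induction s using Finset.induction_on with
  | empty => simp
  | insert a s ha ih =>
    rw [Finset.prod_insert ha, Finset.iInf_insert, ← ih]
    apply le_antisymm
    · refine le_inf ?_ ?_
      · rw [Ideal.span_singleton_le_span_singleton]
        exact dvd_mul_right _ _
      · rw [Ideal.span_singleton_le_span_singleton]
        exact dvd_mul_left _ _
    · rintro b ⟨hba, hbs⟩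
      change b ∈ Ideal.span {f a} at hba
      change b ∈ Ideal.span {∏ i ∈ s, f i} at hbs
      obtain ⟨y, rfl⟩ := Ideal.mem_span_singleton'.mp hba
      -- `y f_a ∈ (f_i)` for `i ∈ s` forces `y ∈ (f_i)` (`a ≠ i`)
      have hy : ∀ i ∈ s, y ∈ Ideal.span {f i} := by
        intro i hi
        have hai : a ∉ ({i} : Set (Fin c)) := fun h => ha (by
          rw [Set.mem_singleton_iff] at h
          exact h ▸ hi)
        have hmem : f a * y ∈ Ideal.span (f '' {i}) := by
          rw [Set.image_singleton, mul_comm]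
          rw [ih] at hbs
          exact (Submodule.mem_iInf _).mp ((Submodule.mem_iInf _).mp hbs i) hi
        have := mem_span_image_of_mul_mem_of_linearIndependent_toCotangent f hf hli a {i} hai y
          hmem
        rwa [Set.image_singleton] at this
      have hy' : y ∈ Ideal.span {∏ i ∈ s, f i} := by
        rw [ih]
        exact (Submodule.mem_iInf _).mpr fun i => (Submodule.mem_iInf _).mpr fun hi => hy i hi
      obtain ⟨z, rfl⟩ := Ideal.mem_span_singleton'.mp hy'
      have hzeq : (z * ∏ i ∈ s, f i) * f a = z * (f a * ∏ i ∈ s, f i) := by ring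
      rw [hzeq]
      exact Ideal.mul_mem_left _ _ (Ideal.mem_span_singleton_self _)

include hli in
/-- Hence `(f₁ ⋯ f_c)` is a radical ideal: it is an intersection of the prime ideals `(fᵢ)`.
[folklore] -/
theorem isRadical_span_singleton_prod_of_linearIndependent_toCotangent :
    (Ideal.span {∏ i, f i}).IsRadical := by
  classical
  rw [span_singleton_prod_eq_iInf_of_linearIndependent_toCotangent f hf hli Finset.univ]
  intro x ⟨n, hn⟩
  refine (Submodule.mem_iInf _).mpr fun i => (Submodule.mem_iInf _).mpr fun hi => ?_
  have hx : x ^ n ∈ Ideal.span {f i} :=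
    (Submodule.mem_iInf _).mp ((Submodule.mem_iInf _).mp hn i) hi
  haveI : (Ideal.span {f i}).IsPrime := by
    have := isPrime_span_image_of_linearIndependent_toCotangent f hf hli {i}
    rwa [Set.image_singleton] at this
  exact Ideal.IsPrime.mem_of_pow_mem ‹_› n hx

include hli in
/-- The radical of `(f₁ ⋯ f_c)` is `(f₁ ⋯ f_c)`. [folklore] -/
theorem radical_span_singleton_prod_of_linearIndependent_toCotangent :
    (Ideal.span {∏ i, f i}).radical = Ideal.span {∏ i, f i} :=
  (isRadical_span_singleton_prod_of_linearIndependent_toCotangent f hf hli).radical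

end Regular

end Literature.AlgebraicGeometry.Resolution

end
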